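import Literature.Algebra.Polynomial.FischerDecomposition
import Mathlib
import HarnessLib

/-!
# LINE g18-A v5 «top-channel cone cut» (crux ⟨stmt-QuantumFields-23125⟩ `RationalToGeneral`, route `F4SubCurvatureDoor`,
# skeleton `Cruxes/RationalToGeneral/Lines/sextic_channel.lean` @ 9dfcf5fb94f6) — RUNG for `stub_channelShellForm`, build-plan step C1

Owner de-risking workfile (planner `ym-idea-3` g18; stub plans `Lines/sextic_channel_stubplans.md` §4, step C1).  Two classical facts
of harmonic-polynomial algebra that the (unstaffed, XL) stub `ChannelShellForm` uses FIRST, to read channel coefficients off a sphere: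

* `eq_zero_of_sum_sq_pow_mul_harmonic_eq_zero` — **graded directness of the Fischer normal form**: if `Σ_{j<N} (Σᵢ xᵢ²)ʲ · Q_j = 0`
  with every `Q_j` harmonic (`Σᵢ ∂ᵢ² Q_j = 0`), then every `Q_j = 0`.  (Induction on `N` from the tree's `ℋ ∩ r²·𝒫 = 0`,
  `Literature.Algebra.Polynomial.FischerDecomposition.disjoint_harmonic_span`, Goodman–Wallach Lemma 5.1.5; this is the uniqueness
  half of Axler–Bourdon–Ramey Thm. 5.7 that `FischerHarmonicNormalForm.lean` deliberately leaves out.)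
* `sum_filter_degree_eq_zero_of_eval_sphere_eq_zero` — **a finite sum of homogeneous harmonic polynomials that vanishes on one sphere
  `Σᵢ xᵢ² = r₀²`, `r₀ > 0`, vanishes degree by degree** (hence identically).  Proof: scaling `x ↦ ±(r₀/‖x‖)·x` onto the sphere and
  homogeneity give, for each parity class, a HOMOGENEOUS polynomial `Σ_m r₀^{2e_m} (Σᵢ xᵢ²)^{D−e_m} H_m` (`d_m = 2e_m + parity`)
  vanishing on `ℝ^ι ∖ {0}`, hence zero (`IsHomogeneous.eq_zero_of_forall_eval_eq_zero`); regrouping by the power of `Σᵢ xᵢ²` and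
  graded directness finish.  No sphere integration, no irreducibility of the quadric, no invariant theory.

Mathlib + the tree's Fischer files only; THEOREMS ONLY; sorry-free.  HONEST FRAMING: classical algebra serving step C1 of the OPEN stub
`ChannelShellForm` of an OPEN line; nothing about the wall T1″ (`AnalyticFiniteType`), C3, crux 23125 / 23035, rung R2d or the summit is
proved here; the Yang–Mills mass gap is NOT proved; no summit is proved by a line. [cite: AxlerBourdonRamey2001, Thm. 5.7]
[cite: GoodmanWallachGTM255, §5.1.2 Lemma 5.1.5]
-/

set_option autoImplicit false

namespace Summit.QuantumFields.YangMills.Cruxes.RationalToGeneral.SexticChannel.Rung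

open MvPolynomial
open scoped BigOperators

noncomputable section

variable {ι : Type*} [Fintype ι]

/-! ## § 1. Harmonic polynomials in the ideal of `r²`; graded directness -/

/-- The operator calculus `D` of the tree's Fischer file sends `Σᵢ Xᵢ²` to the Laplacian (as in
`FischerHarmonicNormalForm.laplacian_eq_algHom_pderiv_sum_sq`, restated here to keep this workfile independent of build order).
[cite: GoodmanWallachGTM255, §5.6.4] -/
theorem algHom_pderiv_sum_sq_apply (D : MvPolynomial ι ℝ →ₐ[ℝ] Module.End ℝ (MvPolynomial ι ℝ))
    (hD : ∀ i, D (X i) =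
      ((pderiv i : Derivation ℝ (MvPolynomial ι ℝ) (MvPolynomial ι ℝ)) :
        Module.End ℝ (MvPolynomial ι ℝ)))
    (P : MvPolynomial ι ℝ) :
    D (∑ i : ι, X i ^ 2) P = ∑ i : ι, pderiv i (pderiv i P) := by
  rw [map_sum, LinearMap.sum_apply]
  refine Finset.sum_congr rfl fun i _ => ?_
  rw [map_pow, sq, Module.End.mul_apply, hD i]
  rfl

/-- A harmonic polynomial lying in the ideal `(Σᵢ xᵢ²)` is zero (tree `disjoint_harmonic_span` with `S = {r²}`).
[cite: GoodmanWallachGTM255, §5.1.2 Lemma 5.1.5] -/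
theorem harmonic_eq_zero_of_mem_span_sum_sq (P : MvPolynomial ι ℝ)
    (hharm : ∑ i : ι, pderiv i (pderiv i P) = 0)
    (hmem : P ∈ Ideal.span ({∑ i : ι, X i ^ 2} : Set (MvPolynomial ι ℝ))) : P = 0 := by
  classical
  obtain ⟨D, hD⟩ :=
    Literature.Algebra.Polynomial.FischerDecomposition.exists_algHom_pderiv (ι := ι)
  have hdisj :=
    Literature.Algebra.Polynomial.FischerDecomposition.disjoint_harmonic_span D hD
      ({∑ i : ι, X i ^ 2} : Set (MvPolynomial ι ℝ))
  rw [Submodule.disjoint_def] at hdisj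
  refine hdisj P ?_ ?_
  · simp only [Submodule.mem_iInf]
    intro g hg
    rw [Set.mem_singleton_iff] at hg
    rw [hg, LinearMap.mem_ker, algHom_pderiv_sum_sq_apply D hD, hharm]
  · rw [Submodule.restrictScalars_mem]
    exact hmem

/-- `Σᵢ xᵢ² ≠ 0` as a polynomial when there is at least one variable. [folklore] -/
theorem sum_sq_ne_zero [Nonempty ι] : (∑ i : ι, X i ^ 2 : MvPolynomial ι ℝ) ≠ 0 := by
  intro h
  have h1 := congrArg (eval fun _ : ι => (1 : ℝ)) h
  simp only [map_sum, map_pow, eval_X, one_pow, Finset.sum_const, Finset.card_univ, nsmul_eq_mul, mul_one,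
    map_zero] at h1
  exact (Nat.cast_ne_zero.mpr (Fintype.card_ne_zero (α := ι))) h1

/-- **Graded directness of the Fischer normal form.**  If `Σ_{j<N} (Σᵢ xᵢ²)ʲ · Q_j = 0` with every `Q_j` harmonic, then
`Q_j = 0` for all `j < N`. [cite: AxlerBourdonRamey2001, Thm. 5.7] -/
theorem eq_zero_of_sum_sq_pow_mul_harmonic_eq_zero [Nonempty ι] (N : ℕ) (Q : ℕ → MvPolynomial ι ℝ)
    (hQ : ∀ j, ∑ i : ι, pderiv i (pderiv i (Q j)) = 0)
    (hsum : ∑ j ∈ Finset.range N, (∑ i : ι, X i ^ 2) ^ j * Q j = 0) :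
    ∀ j, j < N → Q j = 0 := by
  induction N generalizing Q with
  | zero => intro j hj; exact absurd hj (Nat.not_lt_zero j)
  | succ N ih =>
    -- split off the `j = 0` term
    rw [Finset.sum_range_succ'] at hsum
    simp only [pow_zero, one_mul] at hsum
    set T : MvPolynomial ι ℝ := ∑ j ∈ Finset.range N, (∑ i : ι, X i ^ 2) ^ j * Q (j + 1) with hT
    have hfac : ∑ j ∈ Finset.range N, (∑ i : ι, X i ^ 2) ^ (j + 1) * Q (j + 1) =
        (∑ i : ι, X i ^ 2) * T := by
      rw [hT, Finset.mul_sum]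
      refine Finset.sum_congr rfl fun j _ => ?_
      ring
    rw [hfac] at hsum
    -- `Q 0 = -(r² T)` is harmonic and in the ideal of `r²`, hence zero
    have hQ0 : Q 0 = 0 := by
      have hQ0eq : Q 0 = -((∑ i : ι, X i ^ 2) * T) := eq_neg_of_add_eq_zero_right hsum
      refine harmonic_eq_zero_of_mem_span_sum_sq (Q 0) (hQ 0) ?_
      rw [hQ0eq]
      exact Submodule.neg_mem _ (Ideal.mul_mem_right _ _ (Ideal.subset_span rfl))
    rw [hQ0, add_zero] at hsum
    have hT0 : T = 0 := by
      rcases mul_eq_zero.mp hsum with h | h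
      · exact absurd h sum_sq_ne_zero
      · exact h
    have ih' := ih (fun j => Q (j + 1)) (fun j => hQ (j + 1)) (by rw [← hT]; exact hT0)
    intro j hj
    rcases j with _ | j
    · exact hQ0
    · exact ih' j (Nat.lt_of_succ_lt_succ hj)

/-! ## § 2. Scaling of homogeneous polynomials -/

/-- `φ(t·x) = t^n φ(x)` for `φ` homogeneous of degree `n`. [folklore] -/
theorem eval_smul_of_isHomogeneous {σ : Type*} {φ : MvPolynomial σ ℝ} {n : ℕ} (hφ : φ.IsHomogeneous n)
    (t : ℝ) (x : σ → ℝ) : eval (t • x) φ = t ^ n * eval x φ := by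
  rw [eval_eq, eval_eq, Finset.mul_sum]
  refine Finset.sum_congr rfl fun d hd => ?_
  simp only [Pi.smul_apply, smul_eq_mul, mul_pow, Finset.prod_mul_distrib, Finset.prod_pow_eq_pow_sum]
  rw [← hφ.degree_eq_sum_deg_support hd]
  ring

/-- A homogeneous polynomial of positive degree vanishes at the origin. [folklore] -/
theorem eval_zero_of_isHomogeneous_pos {σ : Type*} {φ : MvPolynomial σ ℝ} {n : ℕ} (hφ : φ.IsHomogeneous n)
    (hn : 0 < n) : eval (0 : σ → ℝ) φ = 0 := by
  have h := eval_smul_of_isHomogeneous hφ (0 : ℝ) (0 : σ → ℝ)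
  rw [zero_smul, zero_pow hn.ne', zero_mul] at h
  exact h

/-- A homogeneous real polynomial of positive degree that vanishes away from the origin is zero. [folklore] -/
theorem eq_zero_of_isHomogeneous_of_eval_eq_zero_off_origin {σ : Type*} {φ : MvPolynomial σ ℝ} {n : ℕ}
    (hφ : φ.IsHomogeneous n) (hn : 0 < n) (h : ∀ x : σ → ℝ, x ≠ 0 → eval x φ = 0) : φ = 0 := by
  refine hφ.eq_zero_of_forall_eval_eq_zero fun x => ?_
  by_cases hx : x = 0
  · rw [hx]; exact eval_zero_of_isHomogeneous_pos hφ hn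
  · exact h x hx

/-! ## § 3. Vanishing on a sphere, degree by degree -/

/-- `eval x (Σᵢ Xᵢ²) = Σᵢ xᵢ²`. [folklore] -/
theorem eval_sum_sq (x : ι → ℝ) : eval x (∑ i : ι, X i ^ 2 : MvPolynomial ι ℝ) = ∑ i : ι, x i ^ 2 := by
  simp [map_sum, map_pow, eval_X]

/-- `Σᵢ xᵢ² > 0` for `x ≠ 0`. [folklore] -/
theorem sum_sq_pos_of_ne_zero {x : ι → ℝ} (hx : x ≠ 0) : 0 < ∑ i : ι, x i ^ 2 := by
  rcases Function.ne_iff.mp hx with ⟨i, hi⟩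
  have hi' : x i ≠ 0 := hi
  calc (0 : ℝ) < x i ^ 2 := lt_of_le_of_ne (sq_nonneg _) (Ne.symm (pow_ne_zero 2 hi'))
    _ ≤ ∑ j : ι, x j ^ 2 := Finset.single_le_sum (fun j _ => sq_nonneg (x j)) (Finset.mem_univ i)

/-- Scaling identity: if `Σ_m H_m` (each `H_m` homogeneous of degree `d_m`) vanishes on the sphere `Σᵢ xᵢ² = r₀²`, then for every
`x ≠ 0` and `t` with `t² · Σᵢ xᵢ² = r₀²`: `Σ_m t^{d_m} H_m(x) = 0`. [folklore] -/
theorem sum_pow_mul_eval_eq_zero {M : ℕ} (H : Fin M → MvPolynomial ι ℝ) (d : Fin M → ℕ)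
    (hhom : ∀ m, (H m).IsHomogeneous (d m)) {r₀ : ℝ}
    (hvan : ∀ y : ι → ℝ, ∑ i, y i ^ 2 = r₀ ^ 2 → ∑ m, eval y (H m) = 0)
    (x : ι → ℝ) (t : ℝ) (ht : t ^ 2 * ∑ i, x i ^ 2 = r₀ ^ 2) :
    ∑ m, t ^ (d m) * eval x (H m) = 0 := by
  have hy : ∑ i, (t • x) i ^ 2 = r₀ ^ 2 := by
    simp only [Pi.smul_apply, smul_eq_mul, mul_pow]
    rw [← Finset.mul_sum, ht]
  have h := hvan (t • x) hy
  simpa only [eval_smul_of_isHomogeneous (hhom _)] using h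

/-- Parity extraction: under the hypotheses of `sum_pow_mul_eval_eq_zero` with `t ≠ 0`, the sub-sum over the indices of a fixed
parity `p ∈ {0,1}` already vanishes: `Σ_{d_m ≡ p} (t²)^{d_m / 2} H_m(x) = 0`. [folklore] -/
theorem sum_parity_eq_zero {M : ℕ} (H : Fin M → MvPolynomial ι ℝ) (d : Fin M → ℕ)
    (hhom : ∀ m, (H m).IsHomogeneous (d m)) {r₀ : ℝ}
    (hvan : ∀ y : ι → ℝ, ∑ i, y i ^ 2 = r₀ ^ 2 → ∑ m, eval y (H m) = 0)
    (x : ι → ℝ) (t : ℝ) (ht0 : t ≠ 0) (ht : t ^ 2 * ∑ i, x i ^ 2 = r₀ ^ 2) (p : ℕ) (hp : p < 2) :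
    ∑ m ∈ Finset.univ.filter (fun m => d m % 2 = p), (t ^ 2) ^ (d m / 2) * eval x (H m) = 0 := by
  have h1 := sum_pow_mul_eval_eq_zero H d hhom hvan x t ht
  have h2 := sum_pow_mul_eval_eq_zero H d hhom hvan x (-t) (by rw [neg_sq]; exact ht)
  -- rewrite `t^{d m}` and `(-t)^{d m}` through `d m = 2 (d m / 2) + d m % 2`
  have key : ∀ m, t ^ (d m) = (t ^ 2) ^ (d m / 2) * t ^ (d m % 2) := fun m => by
    conv_lhs => rw [← Nat.div_add_mod (d m) 2]
    rw [pow_add, pow_mul]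
  have key' : ∀ m, (-t) ^ (d m) = (t ^ 2) ^ (d m / 2) * ((-1) ^ (d m % 2) * t ^ (d m % 2)) := fun m => by
    conv_lhs => rw [← Nat.div_add_mod (d m) 2]
    rw [pow_add, pow_mul, neg_sq, neg_pow]
  simp only [key] at h1
  simp only [key'] at h2
  -- even part: h1 + h2; odd part: h1 - h2
  have hsplit : ∀ (c : Fin M → ℝ), ∑ m, c m =
      (∑ m ∈ Finset.univ.filter (fun m => d m % 2 = 0), c m) +
      ∑ m ∈ Finset.univ.filter (fun m => d m % 2 = 1), c m := by
    intro c
    rw [← Finset.sum_filter_add_sum_filter_not Finset.univ (fun m => d m % 2 = 0)]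
    congr 1
    refine Finset.sum_congr ?_ fun _ _ => rfl
    ext m
    simp only [Finset.mem_filter, Finset.mem_univ, true_and]
    omega
  rw [hsplit] at h1 h2
  -- on the even class `(-1)^0 = 1`, on the odd class `(-1)^1 = -1`
  have hE : ∀ m ∈ Finset.univ.filter (fun m => d m % 2 = 0),
      (t ^ 2) ^ (d m / 2) * ((-1) ^ (d m % 2) * t ^ (d m % 2)) * eval x (H m) =
        (t ^ 2) ^ (d m / 2) * t ^ (d m % 2) * eval x (H m) := by
    intro m hm
    rw [Finset.mem_filter] at hm
    rw [hm.2]; ring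
  have hO : ∀ m ∈ Finset.univ.filter (fun m => d m % 2 = 1),
      (t ^ 2) ^ (d m / 2) * ((-1) ^ (d m % 2) * t ^ (d m % 2)) * eval x (H m) =
        -((t ^ 2) ^ (d m / 2) * t ^ (d m % 2) * eval x (H m)) := by
    intro m hm
    rw [Finset.mem_filter] at hm
    rw [hm.2]; ring
  rw [Finset.sum_congr rfl hE, Finset.sum_congr rfl hO, Finset.sum_neg_distrib] at h2
  set A := ∑ m ∈ Finset.univ.filter (fun m => d m % 2 = 0), (t ^ 2) ^ (d m / 2) * t ^ (d m % 2) * eval x (H m)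
  set B := ∑ m ∈ Finset.univ.filter (fun m => d m % 2 = 1), (t ^ 2) ^ (d m / 2) * t ^ (d m % 2) * eval x (H m)
  have hA : A = 0 := by linarith
  have hB : B = 0 := by linarith
  interval_cases p
  · -- even class: `t^{d m % 2} = 1`
    rw [← hA]
    refine Finset.sum_congr rfl fun m hm => ?_
    rw [Finset.mem_filter] at hm
    rw [hm.2, pow_zero, mul_one]
  · -- odd class: `t^{d m % 2} = t`, divide by `t`
    have hB' : B = t * ∑ m ∈ Finset.univ.filter (fun m => d m % 2 = 1),
        (t ^ 2) ^ (d m / 2) * eval x (H m) := by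
      rw [Finset.mul_sum]
      refine Finset.sum_congr rfl fun m hm => ?_
      rw [Finset.mem_filter] at hm
      rw [hm.2, pow_one]; ring
    rw [hB'] at hB
    rcases mul_eq_zero.mp hB with h | h
    · exact absurd h ht0
    · exact h

/-- The parity-class polynomial `F_p = Σ_{d_m ≡ p} r₀^{2 e_m} (Σᵢ xᵢ²)^{D - e_m} H_m` (`e_m = d_m / 2`, all `e_m ≤ D`) vanishes at every
`x ≠ 0` when `Σ_m H_m` vanishes on the sphere of radius `r₀ > 0`. [folklore] -/
theorem eval_parityPoly_eq_zero {M : ℕ} (H : Fin M → MvPolynomial ι ℝ) (d : Fin M → ℕ)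
    (hhom : ∀ m, (H m).IsHomogeneous (d m)) {r₀ : ℝ} (hr₀ : 0 < r₀)
    (hvan : ∀ y : ι → ℝ, ∑ i, y i ^ 2 = r₀ ^ 2 → ∑ m, eval y (H m) = 0)
    (D : ℕ) (hD : ∀ m, d m / 2 ≤ D) (p : ℕ) (hp : p < 2) (x : ι → ℝ) (hx : x ≠ 0) :
    eval x (∑ m ∈ Finset.univ.filter (fun m => d m % 2 = p),
      C (r₀ ^ (2 * (d m / 2))) * (∑ i : ι, X i ^ 2) ^ (D - d m / 2) * H m) = 0 := by
  have hs : 0 < ∑ i, x i ^ 2 := sum_sq_pos_of_ne_zero hx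
  set s : ℝ := ∑ i, x i ^ 2 with hs_def
  -- `t = r₀ / √s`, `t² s = r₀²`
  set t : ℝ := r₀ / Real.sqrt s with ht_def
  have hsqrt : Real.sqrt s ^ 2 = s := Real.sq_sqrt hs.le
  have hsqrt_pos : 0 < Real.sqrt s := Real.sqrt_pos.mpr hs
  have ht0 : t ≠ 0 := div_ne_zero hr₀.ne' hsqrt_pos.ne'
  have ht2 : t ^ 2 = r₀ ^ 2 / s := by rw [ht_def, div_pow, hsqrt]
  have ht : t ^ 2 * ∑ i, x i ^ 2 = r₀ ^ 2 := by
    rw [← hs_def, ht2, div_mul_cancel₀ _ hs.ne']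
  have hpar := sum_parity_eq_zero H d hhom hvan x t ht0 ht p hp
  -- multiply the parity identity by `s ^ D`
  have hmul : s ^ D * ∑ m ∈ Finset.univ.filter (fun m => d m % 2 = p),
      (t ^ 2) ^ (d m / 2) * eval x (H m) = 0 := by rw [hpar, mul_zero]
  rw [Finset.mul_sum] at hmul
  rw [map_sum]
  rw [← hmul]
  refine Finset.sum_congr rfl fun m hm => ?_
  rw [map_mul, map_mul, eval_C, map_pow, eval_sum_sq, ← hs_def, ht2]
  have hsD : s ^ D = s ^ (D - d m / 2) * s ^ (d m / 2) := by
    rw [← pow_add, Nat.sub_add_cancel (hD m)]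
  have hs0 : s ≠ 0 := hs.ne'
  rw [hsD, div_pow, ← pow_mul]
  field_simp

/-- **Vanishing on a sphere, degree by degree.**  If `H_m` (`m < M`) are harmonic homogeneous real polynomials of degrees `d_m` and
`Σ_m H_m` vanishes on the sphere `Σᵢ xᵢ² = r₀²` (`r₀ > 0`, at least one variable), then for every `L` the degree-`L` part
`Σ_{d_m = L} H_m` is the zero polynomial. [cite: AxlerBourdonRamey2001, Thm. 5.7] -/
theorem sum_filter_degree_eq_zero_of_eval_sphere_eq_zero [Nonempty ι] {M : ℕ} (H : Fin M → MvPolynomial ι ℝ)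
    (d : Fin M → ℕ) (hhom : ∀ m, (H m).IsHomogeneous (d m))
    (hharm : ∀ m, ∑ i : ι, pderiv i (pderiv i (H m)) = 0) {r₀ : ℝ} (hr₀ : 0 < r₀)
    (hvan : ∀ y : ι → ℝ, ∑ i, y i ^ 2 = r₀ ^ 2 → ∑ m, eval y (H m) = 0) (L : ℕ) :
    ∑ m ∈ Finset.univ.filter (fun m => d m = L), H m = 0 := by
  classical
  -- a common bound `D ≥ 1` for the half-degrees
  set D : ℕ := (∑ m, d m / 2) + 1 with hD_def
  have hD : ∀ m, d m / 2 ≤ D := fun m => by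
    have : d m / 2 ≤ ∑ m', d m' / 2 :=
      Finset.single_le_sum (fun m' _ => Nat.zero_le (d m' / 2)) (Finset.mem_univ m)
    omega
  set p : ℕ := L % 2 with hp_def
  have hp : p < 2 := Nat.mod_lt L (by norm_num)
  -- the parity-class polynomial and its vanishing
  set F : MvPolynomial ι ℝ := ∑ m ∈ Finset.univ.filter (fun m => d m % 2 = p),
      C (r₀ ^ (2 * (d m / 2))) * (∑ i : ι, X i ^ 2) ^ (D - d m / 2) * H m with hF_def
  have hFhom : F.IsHomogeneous (2 * D + p) := by
    refine IsHomogeneous.sum _ _ _ fun m hm => ?_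
    rw [Finset.mem_filter] at hm
    have h1 : (C (r₀ ^ (2 * (d m / 2))) * (∑ i : ι, X i ^ 2) ^ (D - d m / 2) : MvPolynomial ι ℝ).IsHomogeneous
        (0 + 2 * (D - d m / 2)) := by
      refine (isHomogeneous_C _ _).mul ?_
      have hr2 : (∑ i : ι, X i ^ 2 : MvPolynomial ι ℝ).IsHomogeneous 2 :=
        IsHomogeneous.sum _ _ _ fun i _ => isHomogeneous_X_pow i 2
      exact hr2.pow _
    have h3 := h1.mul (hhom m)
    have hdeg : 0 + 2 * (D - d m / 2) + d m = 2 * D + p := by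
      have := Nat.div_add_mod (d m) 2
      have := hD m
      omega
    rw [hdeg] at h3
    exact h3
  have hF0 : F = 0 :=
    eq_zero_of_isHomogeneous_of_eval_eq_zero_off_origin hFhom (by omega)
      (fun x hx => by rw [hF_def]; exact eval_parityPoly_eq_zero H d hhom hr₀ hvan D hD p hp x hx)
  -- regroup `F` by the power `j = D - e_m` of `r²`
  set Q : ℕ → MvPolynomial ι ℝ := fun j =>
    ∑ m ∈ Finset.univ.filter (fun m => d m % 2 = p ∧ D - d m / 2 = j), C (r₀ ^ (2 * (d m / 2))) * H m with hQ_def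
  have hQharm : ∀ j, ∑ i : ι, pderiv i (pderiv i (Q j)) = 0 := by
    intro j
    simp only [hQ_def, map_sum, pderiv_C_mul]
    rw [Finset.sum_comm]
    refine Finset.sum_eq_zero fun m _ => ?_
    rw [← Finset.mul_sum, hharm m, mul_zero]
  have hFQ : F = ∑ j ∈ Finset.range (D + 1), (∑ i : ι, X i ^ 2) ^ j * Q j := by
    rw [hF_def]
    simp only [hQ_def, Finset.mul_sum]
    rw [← Finset.sum_fiberwise_of_maps_to (s := Finset.univ.filter (fun m => d m % 2 = p))
      (t := Finset.range (D + 1)) (g := fun m => D - d m / 2) (fun m _ => by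
        simp only [Finset.mem_range]; omega)]
    refine Finset.sum_congr rfl fun j _ => ?_
    rw [Finset.filter_filter]
    refine Finset.sum_congr rfl fun m hm => ?_
    rw [Finset.mem_filter] at hm
    rw [← hm.2.2]
    ring
  have hdirect := eq_zero_of_sum_sq_pow_mul_harmonic_eq_zero (D + 1) Q hQharm (by rw [← hFQ]; exact hF0)
  -- read off the degree-`L` part: `L = 2 e + p`; if `e ≤ D` it is `r₀^{-2e} · Q (D - e)`, else it is an empty sum
  set e : ℕ := L / 2 with he_def
  by_cases he : e ≤ D
  · have hQe := hdirect (D - e) (by omega)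
    have hfilt : Finset.univ.filter (fun m => d m % 2 = p ∧ D - d m / 2 = D - e) =
        Finset.univ.filter (fun m => d m = L) := by
      ext m
      simp only [Finset.mem_filter, Finset.mem_univ, true_and]
      have h1 := Nat.div_add_mod (d m) 2
      have h2 := Nat.div_add_mod L 2
      have h3 := hD m
      constructor
      · rintro ⟨hpm, hem⟩
        omega
      · intro hmL
        refine ⟨?_, ?_⟩
        · rw [hp_def, ← hmL]
        · rw [he_def, ← hmL]
    have hQe' : ∑ m ∈ Finset.univ.filter (fun m => d m = L), C (r₀ ^ (2 * (d m / 2))) * H m = 0 := by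
      rw [← hfilt]; exact hQe
    have hQe'' : C (r₀ ^ (2 * e)) * ∑ m ∈ Finset.univ.filter (fun m => d m = L), H m = 0 := by
      rw [Finset.mul_sum, ← hQe']
      refine Finset.sum_congr rfl fun m hm => ?_
      rw [Finset.mem_filter] at hm
      rw [hm.2]
    rcases mul_eq_zero.mp hQe'' with h | h
    · exfalso
      rw [C_eq_zero] at h
      exact pow_ne_zero _ hr₀.ne' h
    · exact h
  · -- no index has degree `L`
    have hempty : Finset.univ.filter (fun m => d m = L) = ∅ := by
      ext m
      simp only [Finset.mem_filter, Finset.mem_univ, true_and, Finset.notMem_empty, iff_false]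
      intro hmL
      have := hD m
      have h2 := Nat.div_add_mod L 2
      subst hmL
      omega
    rw [hempty, Finset.sum_empty]

/-- **Corollary (one polynomial per degree).**  If the `H_m` have pairwise distinct degrees, each `H_m` vanishes.
[cite: AxlerBourdonRamey2001, Thm. 5.7] -/
theorem eq_zero_of_eval_sphere_eq_zero_of_injective [Nonempty ι] {M : ℕ} (H : Fin M → MvPolynomial ι ℝ)
    (d : Fin M → ℕ) (hd : Function.Injective d) (hhom : ∀ m, (H m).IsHomogeneous (d m))
    (hharm : ∀ m, ∑ i : ι, pderiv i (pderiv i (H m)) = 0) {r₀ : ℝ} (hr₀ : 0 < r₀)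
    (hvan : ∀ y : ι → ℝ, ∑ i, y i ^ 2 = r₀ ^ 2 → ∑ m, eval y (H m) = 0) (m : Fin M) : H m = 0 := by
  classical
  have h := sum_filter_degree_eq_zero_of_eval_sphere_eq_zero H d hhom hharm hr₀ hvan (d m)
  have hfilt : Finset.univ.filter (fun m' => d m' = d m) = {m} := by
    ext m'
    simp only [Finset.mem_filter, Finset.mem_univ, true_and, Finset.mem_singleton]
    exact ⟨fun h' => hd h', fun h' => h' ▸ rfl⟩
  rwa [hfilt, Finset.sum_singleton] at h

/-- **Corollary (a single harmonic polynomial).**  A homogeneous harmonic polynomial vanishing on a sphere of positive radius is zero.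
[cite: AxlerBourdonRamey2001, Thm. 5.7] -/
theorem eq_zero_of_harmonic_homogeneous_of_eval_sphere_eq_zero [Nonempty ι] (P : MvPolynomial ι ℝ) {n : ℕ}
    (hhom : P.IsHomogeneous n) (hharm : ∑ i : ι, pderiv i (pderiv i P) = 0) {r₀ : ℝ} (hr₀ : 0 < r₀)
    (hvan : ∀ y : ι → ℝ, ∑ i, y i ^ 2 = r₀ ^ 2 → eval y P = 0) : P = 0 :=
  eq_zero_of_eval_sphere_eq_zero_of_injective (M := 1) (fun _ => P) (fun _ => n)
    (fun a b _ => Subsingleton.elim a b) (fun _ => hhom) (fun _ => hharm) hr₀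
    (fun y hy => by simp only [Finset.univ_unique, Finset.sum_singleton]; exact hvan y hy) 0

end

end Summit.QuantumFields.YangMills.Cruxes.RationalToGeneral.SexticChannel.Rung
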